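import Mathlib
import HarnessLib
import Summits.AtomisticToContinuum.BoseEinsteinCondensation.Theses.BECThomsonPrinciple
import Literature.MathematicalPhysics.QuantumManyBody.PeriodicBoseGas

/-!
# Sketch — first lemmas of the crux-idea cards for `GDTransfer` (stmt-AtomisticToContinuum-9482)

Nothing here is proved; each `def … : Prop` is the first checkable statement of one line of attack,
stated over existing declarations only (they must elaborate, not be true-by-construction).
-/

namespace Summit.AtomisticToContinuum.BoseEinsteinCondensation.Cruxes.GDTransfer.Sketch

open MeasureTheory
open scoped ENNReal ComplexConjugate

open Literature.MathematicalPhysics.QuantumManyBody.BoseGas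

/-- Card `dyson-dressed-witness`, first lemma (FLAT DRESSING IDENTITY). If `g` does not depend on
the coordinate `x₀` and `F` is a real `C¹` periodic dressing factor, the `x₀`-kinetic energy of the
dressed plane wave `η = F · e^{ik·x₀} · g` on the cell splits EXACTLY as
`∫ |∇₀η|² = ∫ (|k|² F² + |∇₀F|²)|g|²` (the cross term is `½∫∇₀(F²)|g|² = 0` by periodicity):
the dressing energy of a flat particle is additive, with no interference with the phase. With
`F = ∏_{j≠0} f(x₀-xⱼ)` and `f` the Dyson profile (`LSSY2005_dysonProfile`), `∫|∇₀F|²|g|²` is then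
bounded by `(N-1)L⁻³ · 4πa(1+O(a/b)) · ‖g‖²`-type terms exactly as in `PeriodicBoseGasJastrow`. -/
def FlatDressingIdentity : Prop :=
  ∀ (m : ℕ) (L : ℝ), 0 < L → ∀ (n : Fin 3 → ℤ) (g : Config (m + 1) → ℂ) (F : Config (m + 1) → ℝ),
    ContDiff ℝ 1 g → ContDiff ℝ 1 F →
    (∀ (X : Config (m + 1)) (y : Space), g (Function.update X 0 y) = g X) →
    (∀ (X : Config (m + 1)) (i : Fin (m + 1)) (l : Fin 3),
        F (X + Pi.single i (EuclideanSpace.single l L)) = F X) →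
    (∀ (X : Config (m + 1)) (i : Fin (m + 1)) (l : Fin 3),
        g (X + Pi.single i (EuclideanSpace.single l L)) = g X) →
    let η : Config (m + 1) → ℂ := fun X =>
      (F X : ℂ) * Complex.exp (Complex.I * ↑(2 * Real.pi / L * ∑ j, (n j : ℝ) * X 0 j)) * g X
    (∫ X in cellN (m + 1) L,
        ∑ l : Fin 3, ‖fderiv ℝ η X (Pi.single 0 (EuclideanSpace.single l (1 : ℝ)))‖ ^ 2) =
      ∫ X in cellN (m + 1) L,
        ((2 * Real.pi / L) ^ 2 * (∑ j, (n j : ℝ) ^ 2) * F X ^ 2 +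
            ∑ l : Fin 3, (fderiv ℝ F X (Pi.single 0 (EuclideanSpace.single l (1 : ℝ)))) ^ 2) *
          ‖g X‖ ^ 2

/-- Card `dual-norm-healed-witness`, first lemma (GD AS A DUAL-NORM BOUND). From
`GaussianDominationCan`, by differentiating the chord inequality along `Φ_t = (Ψ + tη)/‖Ψ + tη‖`
at a minimiser `Ψ` (first variation of the Rayleigh quotient vanishes, `B(Ψ) = 0` is forced by GD
itself): for EVERY `C¹` periodic Bose-symmetric test function `η` (the witness — free; hard-core
admissible witnesses simply have finite form on the right),
`|B(Ψ,η) + B(η,Ψ)|² ≤ 4C (L²/‖n‖²) · (q(η) - E₀‖η‖²)`, where `B` is the polarisation of the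
GD source functional `Φ ↦ 2N ∫ conj Φ · e^{ik·x₀} Θ_Φ` (`= 2⟨Φ, Λ_k† Φ⟩`) and `q` the energy form.
Written additively in `ℝ≥0∞`. KLS is then the single line `‖ζ‖² ≤ 2√(C' q̃(η))/k + ‖ζ - η‖²`. -/
def DualNormBound : Prop :=
  Theses.BECThomsonPrinciple.GaussianDominationCan →
  ∀ v : ℝ → ℝ≥0∞, IsRepulsiveFiniteRange v → ∀ M : ℝ, 0 < M → ∃ ρ₀ C : ℝ, 0 < ρ₀ ∧ 0 < C ∧
    ∃ N₀ : ℕ, ∀ m : ℕ, N₀ ≤ m + 1 → ∀ L : ℝ, 0 < L → ((m + 1 : ℕ) : ℝ) ≤ ρ₀ * L ^ 3 →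
    ∀ n : Fin 3 → ℤ, n ≠ 0 →
      2 * Real.pi * ‖(fun j => (n j : ℝ))‖ / L ≤ M * Real.sqrt ((m + 1 : ℕ) / L ^ 3) →
    ∀ Ψ : PeriodicTrialState (m + 1) L,
      periodicEnergy v Ψ = periodicGroundStateEnergy v (m + 1) L → periodicEnergy v Ψ ≠ ⊤ →
    ∀ η : Config (m + 1) → ℂ, ContDiff ℝ 1 η →
      (∀ (X : Config (m + 1)) (i : Fin (m + 1)) (l : Fin 3),
          η (X + Pi.single i (EuclideanSpace.single l L)) = η X) →
      (∀ (σ : Equiv.Perm (Fin (m + 1))) (X : Config (m + 1)), η (X ∘ σ) = η X) →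
      let P : Fin (m + 1) → (Config (m + 1) → ℂ) → (Config (m + 1) → ℂ) := fun i g X =>
        ((L ^ 3)⁻¹ : ℝ) • ∫ y in cell L, g (Function.update X i y)
      let Q : Finset (Fin (m + 1)) → (Config (m + 1) → ℂ) → (Config (m + 1) → ℂ) := fun S g =>
        (List.finRange (m + 1)).foldr (fun i h => if i ∈ S then P i h else h - P i h) g
      let Θ : (Config (m + 1) → ℂ) → Config (m + 1) → ℂ := fun g X =>
        ∑ S ∈ (Finset.univ : Finset (Finset (Fin (m + 1)))).filter (fun S => (0 : Fin (m + 1)) ∈ S),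
          ((Real.sqrt (S.card : ℝ))⁻¹ : ℂ) * Q S g X
      let wave : Config (m + 1) → ℂ := fun X =>
        Complex.exp (Complex.I * ↑(2 * Real.pi / L * ∑ j, (n j : ℝ) * X 0 j))
      let lhs : ℝ := 2 * (m + 1) *
        ‖(∫ X in cellN (m + 1) L, conj (Ψ.ψ X) * wave X * Θ η X) +
          ∫ X in cellN (m + 1) L, conj (η X) * wave X * Θ Ψ.ψ X‖
      ENNReal.ofReal (lhs ^ 2) +
          ENNReal.ofReal (4 * C * L ^ 2 / ‖(fun j => (n j : ℝ))‖ ^ 2) *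
            periodicGroundStateEnergy v (m + 1) L * ∫⁻ X in cellN (m + 1) L, (‖η X‖₊ : ℝ≥0∞) ^ 2 ≤
        ENNReal.ofReal (4 * C * L ^ 2 / ‖(fun j => (n j : ℝ))‖ ^ 2) *
          ∫⁻ X in cellN (m + 1) L,
            kineticDensity η X + periodicInteraction v L X * (‖η X‖₊ : ℝ≥0∞) ^ 2

/-- Card `gamma-linearised-root`, first lemma (LAPLACE/GAMMA LINEARISATION OF `n̂₀^{-1/2}`).
The LNSS configuration-space object `Θ = P₀ n̂₀^{-1/2} Φ = ∑_{S ∋ 0} |S|^{-1/2} Q_S Φ` (a sum over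
`2^{N-1}` subsets) equals a one-parameter integral of a COMMUTING ONE-BODY PRODUCT:
`Θ = π^{-1/2} ∫₀^∞ t^{-1/2} e^{-t} · P₀ ∏_{i ≠ 0} (1 - (1 - e^{-t}) Pᵢ) Φ dt`
(`|S|^{-1/2} = π^{-1/2}∫₀^∞ t^{-1/2}e^{-t|S|}dt` and `e^{-t n̂₀} = ∏ᵢ (1 - (1-e^{-t})Pᵢ)`). -/
def GammaLinearisation : Prop :=
  ∀ (m : ℕ) (L : ℝ), 0 < L → ∀ (Φ : PeriodicTrialState (m + 1) L) (X : Config (m + 1)),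
    let P : Fin (m + 1) → (Config (m + 1) → ℂ) → (Config (m + 1) → ℂ) := fun i g X =>
      ((L ^ 3)⁻¹ : ℝ) • ∫ y in cell L, g (Function.update X i y)
    let Q : Finset (Fin (m + 1)) → (Config (m + 1) → ℂ) → (Config (m + 1) → ℂ) := fun S g =>
      (List.finRange (m + 1)).foldr (fun i h => if i ∈ S then P i h else h - P i h) g
    let Θ : Config (m + 1) → ℂ := fun X =>
      ∑ S ∈ (Finset.univ : Finset (Finset (Fin (m + 1)))).filter (fun S => (0 : Fin (m + 1)) ∈ S),
        ((Real.sqrt (S.card : ℝ))⁻¹ : ℂ) * Q S Φ.ψ X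
    let R : ℝ → (Config (m + 1) → ℂ) → (Config (m + 1) → ℂ) := fun t g =>
      (List.finRange (m + 1)).foldr
        (fun i h => if i = 0 then P i h else h - ((1 - Real.exp (-t) : ℝ) : ℂ) • P i h) g
    Θ X = ((Real.sqrt Real.pi)⁻¹ : ℂ) *
      ∫ t in Set.Ioi (0 : ℝ), ((t ^ (-(1 / 2 : ℝ)) * Real.exp (-t) : ℝ) : ℂ) * R t Φ.ψ X

end Summit.AtomisticToContinuum.BoseEinsteinCondensation.Cruxes.GDTransfer.Sketch
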